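import Mathlib
import HarnessLib
import Summits.AtomisticToContinuum.Crystallization.Theorems.FrustratedLawDichotomySphericalPairCheck
import Summits.AtomisticToContinuum.Crystallization.Theorems.FrustratedLawDichotomySphericalPairCells

/-!
# FrustratedLawDichotomy · `P` by certified numerics: the `hcp` `√2`-diagonal pair-target stream passes the check

`Rig.checkAllT hcpModel [(0, 6, CSqrt2)] hcpSqrt2Cells = true`, evaluated by `native_decide` (exact integer replay, at
scale `2^60`, of the LP dual certificates of the retargeted deviation-run cells `Rig.hcpSqrt2Cells` of
`…SphericalPairCells`; about 170 s).  With `…SphericalPairCheck.sphericalPairBound_of_pairChecks` this is the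
spherical-code pair bound for the representative `(0, 6)`; assembled in `…CapForcingHundredth`.
-/

namespace Summit.AtomisticToContinuum.Crystallization.Theorems

namespace Rig

open FrustratedLawDichotomySphericalPairCheck (CSqrt2)

/-- **The `hcp` `√2`-diagonal pair-target stream passes the check** (class `computational`). -/
theorem hcpSqrt2_checkAllT : checkAllT hcpModel [⟨0, 6, CSqrt2⟩] hcpSqrt2Cells = true := by
  native_decide

end Rig

end Summit.AtomisticToContinuum.Crystallization.Theorems
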